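import Literature.MathematicalPhysics.QuantumFieldTheory.Balaban1983to89.B9Ineq347AllEntries
import Literature.MathematicalPhysics.QuantumFieldTheory.Balaban1983to89.B9Ineq368PPrime
import Literature.MathematicalPhysics.QuantumFieldTheory.Balaban1983to89.B8ScaledSupNorm

/-!
# `Balaban1983to89.B8Ineq198R` — B8 p. 92, (1.98) R-half «|Rf|₍₋₂₎ ≦ B′₀|f|₍₋₂₎» and p. 92 l. 17–18
# «from Theorems 3.1, 3.2 of [4] it follows that |Rf| ≦ B′₀|f|», KERNEL-CHECKED at the function level of [4]
# (block-majorant operator form, no composition dictionary) from (3.49) + Lemma 2.1 of [Balaban1984PropagatorsII]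

statement-level skeleton of published theorems with citation tags; proofs where landed; nothing here is a claim
about the Yang–Mills mass gap

CITATION HEADER (lean-in-tree rule 2026-08-18; mega-formalization `lit-balaban`, reader/typer seat r05 gen 13, free
target under protocol G.5-34(d); SKELETON row `B8.Eq1.99` = (1.97)–(1.99), member (1.98) R-half).  T. Bałaban,
*Spaces of regular gauge field configurations on a lattice and gauge fixing conditions*, Commun. Math. Phys. **99**
(1985) 75–102 `[Balaban1985RegularSpaces]` ("B8"; held `paper:balaban1985-cmp99-regular-spaces-gauge-fixing`,
journal page = PDF page + 74), p. 92 [PDF 18], read on the page render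
`pub-balaban/b2b-balaban-ref1/pages/…/1985-cmp99-regular-spaces-gauge-fixing-p018-x2.png`, verbatim:

> «Let us recall that from Theorems 3.1, 3.2 of [4] it follows that |Rf| ≦ B′₀|f|, hence the operator R[…]R has a
> L^∞ norm bounded by O(α₄)B′₀².» (l. 17–18)  …  «Thus it is a function with a bounded norm |·|₍₋₂₎.  The operators
> R and V are bounded in this norm, and we have |Rf|₍₋₂₎ ≦ B′₀|f|₍₋₂₎, |Vf|₍₋₂₎ ≦ O(α₄)|f|₍₋₂₎. (1.98)»

Here [4] = T. Bałaban, *Propagators for lattice gauge theories in a background field*, Commun. Math. Phys. **99**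
(1985) 389–434 `[Balaban1985BackgroundPropagators]` ("B9"; `paper:balaban1985-cmp99-background-propagators`, journal
page = PDF page + 388), whose results used are (render `…-p011-x2.png`), p. 399 [PDF 11], verbatim: «These theorems
imply all the properties of the operator R, or DRD\*, we will need in the future. For the operator P = I − R we
obtain, using again Lemma 2.1, [|P(x,x′)|, |(DP)_μ(x,x′)|, |(PD\*)_ν(x,x′)|, |(DPD\*)_{μν}(x,x′)|] ≦ O(1)[1, (Lʲη)⁻¹,
(Lʲη)⁻¹, (Lʲη)⁻²](L^{j′}η)^{−d}e^{−(1/2)δ₀d(y,y′)} for x ∈ Δ(y), y ∈ Λ_j, x′ ∈ Δ(y′), y′ ∈ Λ_{j′}. (3.49)»; the norms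
are (3.41) p. 397 [PDF 9]: «|A|₍α₎ = sup_{0≦j≦k} sup_{b∈Ω_j∖Ω_{j+1}} (Lʲη)^{−α}|A(b)|. (3.41) Thus the norm |A|₍α₎ can
be defined as the smallest number C such, that |A(b)| ≦ C(Lʲη)^α for b ∈ Ω_j∖Ω_{j+1}, j = 0, 1, …, k. For α negative
we can take Ω_j instead of Ω_j∖Ω_{j+1} above.»; and the scale-transfer remark p. 398 [PDF 10]: «Using Lemma 2.1 in
[4] we may replace the factor (Lʲη)^α by (Lʲη)^β(L^{j′}η)^γ with β + γ = α, j, j′ are indices of localizations.»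
"Lemma 2.1" = T. Bałaban, *Propagators and renormalization transformations for lattice gauge theories. II*, Commun.
Math. Phys. **96** (1984) 223–250 `[Balaban1984PropagatorsII]` ("B6"), p. 234 [PDF 12]: (2.60) «e^{−αδ₀d(y,y′)} ≦
e^{−αδ₀RM max{|j−j′|−1,0}}, y ∈ Λ_j, y′ ∈ Λ_{j′}», (2.61) «sup_{y∈𝔅} Σ_{y′∈𝔅} e^{−αδ₀d(y,y′)} ≦ c₁(α)».  B8's own
recall of the norm, p. 86 [PDF 12]: «|A|₍α₎ = sup_j sup_{Ω_j} (Lʲη)^{−α}|A|» (typed `B8ScaledSupNorm.msup`).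

STATUS IN THE TREE BEFORE THIS FILE (read first; nothing below restates it).  The (1.98) R-half is a NAMED
HYPOTHESIS of the Sect. D / Sect. H files: `B8SectDSource.thm8_sectD_inspected`, `propFive_source` take `‖R‖ ≤ B′₀`
as an operator-norm bound between the |·|₍₋₂₎-spaces (its header: «(1.98): ‖R‖ ≤ B′₀ … which a reader must still
discharge from the printed text»); `B8Ineq192` (b2b-balaban-b08) proves the SUP-norm sentence of p. 92 l. 17–18 as
a weighted row sum of the pointwise (3.49) kernel (`rowsum_of_349`, `rf_bound`) MODULO its fine-sum dictionary (iv)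
and lists «(vi) the weighted-norm versions (1.98) |Rf|₍₋₂₎ ≦ B′₀|f|₍₋₂₎ and (1.101)» as NOT REPRODUCED; the (1.98)
V-half is `B8Ineq197.ineq198_local` (r05 g5).  On the [4] side the inputs exist at FUNCTION level: (3.49) entry 0 in
the block-majorant OPERATOR form «P ≺ κ·e^{−ρd}» is `B9Ineq368PPrime.ineq349_op` (r06 g6; from Theorem 3.1/3.2-shaped
letters, no composition dictionary), and p27 g7's `B9Ineq347AllEntries` kernel-checks [4]'s «(3.47) from (3.42) and
Lemma 2.1» with the weight (Lʲη)^γ identified (`glob347_of_342_weighted`, `weight_ratio`, `h260_nat_of_Ineq260`,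
located size condition |γ|·log L ≦ αδ₀RM).

WHAT THIS FILE PROVES (theorems only; 0 `def`, 0 new facts, 0 sorry; every analytic input a hypothesis OF PRINTED
SHAPE, named).  Setting = pv08's `B6RandomWalk.HasMajorant blk P K` over `B9Thm34Ext.toB6 g R H` (one function space
`X → ℝ` with block map `blk : X → 𝔅`; real functions = modulus profiles, as in every block-majorant file of the
cell), the weight of (3.41) `w(y) = (L^{j(y)}η)^γ = (g.len y)^γ`:
* §1 `weighted_of_decay` — an operator with an UNWEIGHTED exponentially decaying majorant, «P ≺ κe^{−δd}» (the shape
  of (3.49) entry 0 in operator form: the coarse-measure weight (L^{j′}η)^d of the block sum cancels the printed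
  (L^{j′}η)^{−d}), is bounded in EVERY norm |·|₍γ₎: under (2.60) (exponent α), (2.61) (at 1 − α) and |γ|·log L ≦ αδRM,
  |λ(x)| ≦ (L^{j′}η)^γN on every Δ(y′) implies |(Pλ)(x)| ≦ κc₁(1−α)L^{|γ|}·(Lʲη)^γ·N for x ∈ Δ(y), y ∈ Λ_j — i.e.
  |Pλ|₍γ₎ ≦ κc₁(1−α)L^{|γ|}|λ|₍γ₎ (= `glob347_of_342_weighted` with P(y) ≡ 1); `weighted_one_sub` — for R = I − P:
  |Rλ|₍γ₎ ≦ (1 + κc₁(1−α)L^{|γ|})|λ|₍γ₎.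
* §2 **`ineq198_R`** — γ = −2: «|Rf|₍₋₂₎ ≦ B′₀|f|₍₋₂₎» with **B′₀ = 1 + κc₁(1−α)L²** under 2·log L ≦ αδRM (the R-half
  of (1.98) as printed, function level, no dictionary); `rf_sup_bound` — γ = 0: p. 92 l. 17–18 «|Rf| ≦ B′₀|f|» with
  B′₀ = 1 + κc₁(1−α), no size condition (dictionary-free form of `B8Ineq192.rowsum_of_349` + `rf_bound`);
  `ineq198_R_compact` — ONE constant 1 + κc₁(1−α)L⁴ for every γ ∈ [−4, 4] under 4·log L ≦ αδRM ([4]'s compact-set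
  convention of (3.47)).
* §3 **`ineq198_R_of_thms3132`** — END TO END from the Theorem 3.1/3.2-shaped letters of `B9Ineq368PPrime.ineq349_op`
  (G′ ≺ B₀(Lʲη)²e^{−δd}, ∇G′, G′∇\* ≺ B₀Lʲηe^{−δd}, (Q′G′²Q′\*)⁻¹ ≺ B₁(Lʲη)⁻⁴e^{−δd}, Q′, Q′\* block-local with norm κ_Q,
  the three scale transfers, (2.61) at β, (2.54)) for P = `B9Eq360Vprime.pOp G Qs Cinv Q` = G′Q′\*(Q′G′²Q′\*)⁻¹Q′G′ of
  (3.25), plus (2.60)/(2.61) at the output rate ρ and 2·log L ≦ α′ρRM: |(I − P)f|₍₋₂₎ ≦ (1 + κ₃₄₉c₁(1−α′)L²)|f|₍₋₂₎,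
  κ₃₄₉ = `B9Ineq368PPrime.kappa349 κ_Q B₀ B₁ Λ c₁(β)` — "B′₀ is an absolute constant (depending on d and L only)"
  in the printed sense (through B₀, B₁, κ_Q, Λ, c₁, L).
* §4 DICTIONARY between B8's p. 86 norm `B8ScaledSupNorm.msup L k η α mem F` («sup_j sup_{Ω_j}», nested domains read
  through the top scale `sc i` of the index: `mem j i → j ≦ sc i`, `mem (sc i) i`) and [4]'s block form of (3.41)
  used in §§1–3 (`‖F i‖ ≦ (L^{sc i}η)^α·N`): `msup_le_of_blockwise` (for α ≦ 0 — «For α negative we can take Ω_j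
  instead of Ω_j∖Ω_{j+1} above», B9 p. 397) and `blockwise_of_msup_le` (any α).

HONEST SCOPE / NOT CLAIMED.  (i) (3.49) itself, Theorems 3.1/3.2 and Lemma 2.1 are hypotheses of printed shape (all
have kernel derivations or typed leaves in the tree: `B9Ineq368PPrime.ineq349_op`, `B9.Thm31and32Printed`,
`B6.Lemma21Printed`/`B6RandomWalk.Ineq260`/`Ineq261`); the R of §§1–2 is ANY `I − P` with P of the (3.49)₀ operator
shape — its identification with B8's Landau projection R(U₀) of (1.27) is B8 p. 80–81 / [4] (3.25) (in the tree:
`B8Eq127LandauGauge.isLandauBG_iff_R325_eq_zero`, `B9Eq360Vprime.pOp`).  (ii) OPERATOR form: as in every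
block-majorant file, a majorant bounds block sup-norms of `Pλ` for block-supported λ; the printed POINTWISE kernel
bound of (3.49) is stronger (pv16's `B9Ineq349`).  (iii) The (1.98) V-half is `B8Ineq197.ineq198_local`; (1.99) and
(1.101) are NOT derived here.  (iv) The size condition |γ|·log L ≦ αδRM is the located largeness of M behind «using
again Lemma 2.1» (as in `B9Ineq347AllEntries`, `B8Ineq192`'s L⁴ ≦ e^{εRM}); print does not display it.  NOTHING of
the series' end-statement (ultraviolet stability) is asserted; value = one named hypothesis of the cell's Sect. D
certification discharged in printed shape from [4], NOT summit progress.

RELATED IN THE TREE, NOT DUPLICATED (searched 2026-08-21T22:50Z: `ls Balaban1983to89/ | grep -i 198` = `B16Exp198*`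
only; `grep Ineq198 FILED.md` = 0; `lean search 'rowsum_of_349|glob347_of_342'`): `B8Ineq192.rowsum_of_349`/`rf_bound`
(sup norm, kernel form, modulo dictionary), `B8Ineq197.ineq198_local` (V-half), `B9Ineq347AllEntries.*` and
`B9Ineq368PPrime.ineq349_op` (USED BY NAME), `B8ScaledSupNorm.*` (USED BY NAME), `B8SectDSource.*` (the consumer
of the hypothesis `‖R‖ ≤ B′₀`; not modified).
-/

noncomputable section

namespace Literature.MathematicalPhysics.QuantumFieldTheory.Balaban1983to89.B8Ineq198R

open Literature.MathematicalPhysics.QuantumFieldTheory.Balaban1983to89.B6RandomWalk (HasMajorant Ineq260 Ineq261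
  Triangle254 hasMajorant_mono)
open Literature.MathematicalPhysics.QuantumFieldTheory.Balaban1983to89.B6RandomWalkHom (HasMajorantHom
  hasMajorantHom_iff)
open Literature.MathematicalPhysics.QuantumFieldTheory.Balaban1983to89.B9Thm34Ext (toB6)
open Literature.MathematicalPhysics.QuantumFieldTheory.Balaban1983to89.B9Ineq347 (ScaleTransfer)
open Literature.MathematicalPhysics.QuantumFieldTheory.Balaban1983to89.B9Ineq347AllEntries (glob347_of_342_weighted
  glob347_of_342_end size_condition_compact)

/-! ## §1  An operator with an unweighted decaying majorant is bounded in every norm `|·|₍γ₎` -/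

section Weighted

variable {g : B9.Geometry} [Fintype g.Site] {R : ℝ} {H : Prop} {X : Type}

/-- **The mechanism of (1.98), R-half** (B8 p. 92: «The operators R and V are bounded in this norm»; [4] p. 398:
«Using Lemma 2.1 in [4] we may replace the factor (Lʲη)^α by (Lʲη)^β(L^{j′}η)^γ with β + γ = α»).  If an operator P
on the functions of ONE lattice (block map `blk`) has the unweighted decaying majorant «|(Pλ)(x)| ≦ κe^{−δd(y,y′)}|λ|,
x ∈ Δ(y), supp λ ⊂ Δ(y′)» (the operator shape of (3.49) entry 0, the coarse weight (L^{j′}η)^d of the block sum having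
cancelled the printed (L^{j′}η)^{−d}), κ ≧ 0, and Lemma 2.1 holds for the geometry ((2.60) at the exponent α,
(2.61) at 1 − α, typed by pv08), L ≧ 1, η > 0 and the size condition |γ|·log L ≦ αδRM holds, then for every λ with
|λ(x′)| ≦ (L^{j′}η)^γ·N on Δ(y′), y′ ∈ Λ_{j′} (i.e. |λ|₍γ₎ ≦ N, N ≧ 0):
`|(Pλ)(x)| ≦ κ·c₁(1−α)·L^{|γ|}·(Lʲη)^γ·N` for x ∈ Δ(y), y ∈ Λ_j — i.e. |Pλ|₍γ₎ ≦ κc₁(1−α)L^{|γ|}·|λ|₍γ₎.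
(`B9Ineq347AllEntries.glob347_of_342_weighted` with the bracket P(y) ≡ 1.)
[cite: Balaban1985RegularSpaces, (1.98) p.92; Balaban1985BackgroundPropagators, (3.49) p.399 + remark after (3.47) p.398; Balaban1984PropagatorsII, Lemma 2.1 (2.60)–(2.61) p.234] -/
theorem weighted_of_decay (blk : X → g.Site) (d : ℕ) (δ α κ γ N : ℝ) (hκ : 0 ≤ κ) (hN : 0 ≤ N)
    (hL : 1 ≤ g.L) (hη : 0 < g.eta) (hsize : |γ| * Real.log g.L ≤ α * δ * R * g.M)
    (h260 : Ineq260 (toB6 g R H) δ α) (h261 : Ineq261 d (toB6 g R H) δ (1 - α))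
    {P : Module.End ℝ (X → ℝ)}
    (hP : HasMajorant (g := toB6 g R H) blk P (fun a b => κ * Real.exp (-(δ * g.dist a b))))
    (μ : X → ℝ) (hμ : ∀ x, |μ x| ≤ (g.len (blk x)) ^ γ * N) (x : X) :
    |P μ x| ≤ κ * B6.c1 d δ (1 - α) * g.L ^ |γ| * (g.len (blk x)) ^ γ * N := by
  -- the same majorant, written with the bracket `P(y) ≡ 1` of `glob347_of_342_weighted`, two-space form with X = Y
  have hP1 : HasMajorant (g := toB6 g R H) blk P
      (fun a b => κ * (fun _ : g.Site => (1 : ℝ)) a * Real.exp (-(δ * g.dist a b))) :=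
    hasMajorant_mono (g := toB6 g R H) blk hP fun a b => by simp
  have h342 : HasMajorantHom (g := toB6 g R H) blk blk P
      (fun a b => κ * (fun _ : g.Site => (1 : ℝ)) a * Real.exp (-(δ * g.dist a b))) :=
    (hasMajorantHom_iff (g := toB6 g R H) blk P _).2 hP1
  have h := glob347_of_342_weighted (R := R) (H := H) blk blk d δ α κ γ N (fun _ => (1 : ℝ)) hκ
    (fun _ => zero_le_one) hN hL hη hsize h260 h261 h342 μ hμ x
  simpa only [mul_one] using h

/-- **R = I − P is bounded in every norm `|·|₍γ₎`** (B8 p. 92 (1.98), R-half mechanism; [4] (3.25) p. 394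
«P = I − R»): under the hypotheses of `weighted_of_decay`, |((I − P)λ)(x)| ≦ (1 + κc₁(1−α)L^{|γ|})·(Lʲη)^γ·N for
x ∈ Δ(y), y ∈ Λ_j — i.e. |Rλ|₍γ₎ ≦ (1 + κc₁(1−α)L^{|γ|})|λ|₍γ₎.
[cite: Balaban1985RegularSpaces, (1.98) p.92; Balaban1985BackgroundPropagators, (3.25) p.394 + (3.49) p.399] -/
theorem weighted_one_sub (blk : X → g.Site) (d : ℕ) (δ α κ γ N : ℝ) (hκ : 0 ≤ κ) (hN : 0 ≤ N)
    (hL : 1 ≤ g.L) (hη : 0 < g.eta) (hsize : |γ| * Real.log g.L ≤ α * δ * R * g.M)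
    (h260 : Ineq260 (toB6 g R H) δ α) (h261 : Ineq261 d (toB6 g R H) δ (1 - α))
    {P : Module.End ℝ (X → ℝ)}
    (hP : HasMajorant (g := toB6 g R H) blk P (fun a b => κ * Real.exp (-(δ * g.dist a b))))
    (μ : X → ℝ) (hμ : ∀ x, |μ x| ≤ (g.len (blk x)) ^ γ * N) (x : X) :
    |(1 - P) μ x| ≤ (1 + κ * B6.c1 d δ (1 - α) * g.L ^ |γ|) * ((g.len (blk x)) ^ γ * N) := by
  have hPμ := weighted_of_decay (R := R) (H := H) blk d δ α κ γ N hκ hN hL hη hsize h260 h261 hP μ hμ x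
  have hsub : (1 - P) μ x = μ x - P μ x := rfl
  rw [hsub]
  calc |μ x - P μ x| ≤ |μ x| + |P μ x| := abs_sub _ _
    _ ≤ (g.len (blk x)) ^ γ * N + κ * B6.c1 d δ (1 - α) * g.L ^ |γ| * (g.len (blk x)) ^ γ * N :=
        add_le_add (hμ x) hPμ
    _ = (1 + κ * B6.c1 d δ (1 - α) * g.L ^ |γ|) * ((g.len (blk x)) ^ γ * N) := by ring

end Weighted

/-! ## §2  (1.98) R-half (γ = −2), the sup-norm sentence of p. 92 l. 17–18 (γ = 0), and the compact-set form -/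

section Ineq198

variable {g : B9.Geometry} [Fintype g.Site] {R : ℝ} {H : Prop} {X : Type}

/-- **(1.98), R-half, as printed: «|Rf|₍₋₂₎ ≦ B′₀|f|₍₋₂₎»** (B8 p. 92), for R = I − P with P of the (3.49)₀ operator
shape «P ≺ κe^{−δd}», KERNEL-CHECKED from Lemma 2.1 of [Balaban1984PropagatorsII] ((2.60) at α, (2.61) at 1 − α)
under the located size condition 2·log L ≦ αδRM, with the EXPLICIT constant **B′₀ = 1 + κ·c₁(1−α)·L²**: if
|f(x′)| ≦ (L^{j′}η)⁻²·N on every block Δ(y′), y′ ∈ Λ_{j′} (|f|₍₋₂₎ ≦ N), then |(Rf)(x)| ≦ B′₀(Lʲη)⁻²N for x ∈ Δ(y),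
y ∈ Λ_j.  Function level, no composition or test-function dictionary.
[cite: Balaban1985RegularSpaces, (1.98) p.92; Balaban1985BackgroundPropagators, (3.49) p.399, (3.41) p.397; Balaban1984PropagatorsII, Lemma 2.1 (2.60)–(2.61) p.234] -/
theorem ineq198_R (blk : X → g.Site) (d : ℕ) (δ α κ N : ℝ) (hκ : 0 ≤ κ) (hN : 0 ≤ N)
    (hL : 1 ≤ g.L) (hη : 0 < g.eta) (hsize : 2 * Real.log g.L ≤ α * δ * R * g.M)
    (h260 : Ineq260 (toB6 g R H) δ α) (h261 : Ineq261 d (toB6 g R H) δ (1 - α))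
    {P : Module.End ℝ (X → ℝ)}
    (hP : HasMajorant (g := toB6 g R H) blk P (fun a b => κ * Real.exp (-(δ * g.dist a b))))
    (f : X → ℝ) (hf : ∀ x, |f x| ≤ (g.len (blk x)) ^ (-(2 : ℝ)) * N) (x : X) :
    |(1 - P) f x| ≤ (1 + κ * B6.c1 d δ (1 - α) * g.L ^ 2) * ((g.len (blk x)) ^ (-(2 : ℝ)) * N) := by
  have habs : |(-(2 : ℝ))| = 2 := by norm_num
  have hsize' : |(-(2 : ℝ))| * Real.log g.L ≤ α * δ * R * g.M := by rw [habs]; exact hsize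
  have h := weighted_one_sub (R := R) (H := H) blk d δ α κ (-(2 : ℝ)) N hκ hN hL hη hsize' h260 h261 hP f hf x
  rw [habs, Real.rpow_two] at h
  exact h

/-- **p. 92 l. 17–18: «from Theorems 3.1, 3.2 of [4] it follows that |Rf| ≦ B′₀|f|»** — the SUP-norm boundedness
of R = I − P (γ = 0), dictionary-free: if P ≺ κe^{−δd} (operator form of (3.49)₀; κ ≧ 0), (2.61) holds at 1 − α with
0 ≦ αδ·d(y,y′) (so that no scale transfer is needed: the weight is 1), then |f| ≦ N implies |(Rf)(x)| ≦ (1 + κc₁(1−α))N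
— **B′₀ = 1 + κc₁(1−α)**.  (The kernel-level form modulo the fine-sum dictionary is `B8Ineq192.rowsum_of_349` +
`rf_bound`.) [cite: Balaban1985RegularSpaces, p.92 l.17–18; Balaban1985BackgroundPropagators, (3.49) p.399; Balaban1984PropagatorsII, Lemma 2.1 (2.61) p.234] -/
theorem rf_sup_bound (blk : X → g.Site) (d : ℕ) (δ α κ N : ℝ) (hκ : 0 ≤ κ) (hN : 0 ≤ N)
    (hαδ : 0 ≤ α * δ) (hdnn : ∀ a b : g.Site, 0 ≤ g.dist a b)
    (h261 : Ineq261 d (toB6 g R H) δ (1 - α))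
    {P : Module.End ℝ (X → ℝ)}
    (hP : HasMajorant (g := toB6 g R H) blk P (fun a b => κ * Real.exp (-(δ * g.dist a b))))
    (f : X → ℝ) (hf : ∀ x, |f x| ≤ N) (x : X) :
    |(1 - P) f x| ≤ (1 + κ * B6.c1 d δ (1 - α)) * N := by
  -- trivial scale transfer for the constant weight 1
  have hST : ScaleTransfer g δ α 1 (fun _ : g.Site => (1 : ℝ)) := by
    intro y y'
    have hexp : Real.exp (-(α * δ * g.dist y y')) ≤ 1 := by
      rw [Real.exp_le_one_iff]
      have := mul_nonneg hαδ (hdnn y y')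
      linarith
    simpa using hexp
  have hP1 : HasMajorant (g := toB6 g R H) blk P
      (fun a b => κ * (fun _ : g.Site => (1 : ℝ)) a * Real.exp (-(δ * g.dist a b))) :=
    hasMajorant_mono (g := toB6 g R H) blk hP fun a b => by simp
  have hf1 : ∀ x', |f x'| ≤ (fun _ : g.Site => (1 : ℝ)) (blk x') * N := fun x' => by simpa using hf x'
  have hPf := glob347_of_342_end (R := R) (H := H) blk d δ α κ 1 N (fun _ => (1 : ℝ)) (fun _ => (1 : ℝ)) hκ
    (fun _ => zero_le_one) (fun _ => zero_le_one) hN h261 hST hP1 f hf1 x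
  have hPf' : |P f x| ≤ κ * B6.c1 d δ (1 - α) * N := by simpa only [mul_one] using hPf
  have hsub : (1 - P) f x = f x - P f x := rfl
  rw [hsub]
  calc |f x - P f x| ≤ |f x| + |P f x| := abs_sub _ _
    _ ≤ N + κ * B6.c1 d δ (1 - α) * N := add_le_add (hf x) hPf'
    _ = (1 + κ * B6.c1 d δ (1 - α)) * N := by ring

/-- **(1.98) R-half uniformly on [4]'s compact set «e.g. for γ ∈ [−4, 4]»** (B9 p. 398): under the ONE size condition
4·log L ≦ αδRM, for every γ with |γ| ≦ 4 and every f with |f|₍γ₎ ≦ N: |((I − P)f)(x)| ≦ (1 + κc₁(1−α)L⁴)(Lʲη)^γN for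
x ∈ Δ(y), y ∈ Λ_j — ONE constant for the whole compact set; γ = −2 is (1.98), γ = 0 is p. 92 l. 17–18.
[cite: Balaban1985RegularSpaces, (1.98) p.92; Balaban1985BackgroundPropagators, (3.47)–(3.49) pp.398–399] -/
theorem ineq198_R_compact (blk : X → g.Site) (d : ℕ) (δ α κ : ℝ) (hκ : 0 ≤ κ)
    (hL : 1 ≤ g.L) (hη : 0 < g.eta) (hsize : 4 * Real.log g.L ≤ α * δ * R * g.M)
    (h260 : Ineq260 (toB6 g R H) δ α) (h261 : Ineq261 d (toB6 g R H) δ (1 - α))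
    {P : Module.End ℝ (X → ℝ)}
    (hP : HasMajorant (g := toB6 g R H) blk P (fun a b => κ * Real.exp (-(δ * g.dist a b))))
    (γ : ℝ) (hγ : |γ| ≤ 4) (N : ℝ) (hN : 0 ≤ N)
    (f : X → ℝ) (hf : ∀ x, |f x| ≤ (g.len (blk x)) ^ γ * N) (x : X) :
    |(1 - P) f x| ≤ (1 + κ * B6.c1 d δ (1 - α) * g.L ^ (4 : ℝ)) * ((g.len (blk x)) ^ γ * N) := by
  have hL0 : 0 < g.L := lt_of_lt_of_le one_pos hL
  obtain ⟨hsz, hL4⟩ := size_condition_compact g.L γ _ hL hγ hsize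
  have h := weighted_one_sub (R := R) (H := H) blk d δ α κ γ N hκ hN hL hη hsz h260 h261 hP f hf x
  refine h.trans ?_
  have hc1 : 0 ≤ κ * B6.c1 d δ (1 - α) :=
    mul_nonneg hκ ((Finset.sum_nonneg fun _ _ => Real.exp_nonneg _).trans (h261 (blk x)))
  have hw : 0 ≤ (g.len (blk x)) ^ γ * N :=
    mul_nonneg (B9Ineq347AllEntries.weight_nonneg g hL0 hη γ _) hN
  have hconst : 1 + κ * B6.c1 d δ (1 - α) * g.L ^ |γ| ≤ 1 + κ * B6.c1 d δ (1 - α) * g.L ^ (4 : ℝ) := by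
    have := mul_le_mul_of_nonneg_left hL4 hc1
    linarith
  exact mul_le_mul_of_nonneg_right hconst hw

end Ineq198

/-! ## §3  End to end from the Theorem 3.1/3.2-shaped letters of [4]: P = G′Q′\*(Q′G′²Q′\*)⁻¹Q′G′ of (3.25) -/

section EndToEnd

variable {g : B9.Geometry} [Fintype g.Site] [DecidableEq g.Site] {R : ℝ} {H : Prop} {W : Type}

/-- **(1.98) R-half END TO END from Theorems 3.1, 3.2 of [4] (as letter-shaped hypotheses) and Lemma 2.1** — B8
p. 92 «from Theorems 3.1, 3.2 of [4] it follows that … |Rf|₍₋₂₎ ≦ B′₀|f|₍₋₂₎».  Letters in ONE `Module.End ℝ (W → ℝ)`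
(W carries sites, bonds and 𝔅; block map `blk`) exactly as in `B9Ineq368PPrime.ineq349_op`: G = G′(U) ≺
B₀(Lʲη)²e^{−δd}, D·G ≺ B₀Lʲηe^{−δd}, G·D\* ≺ B₀Lʲηe^{−δd} ((3.42)₁,₂,₃), Cinv = (Q′G′²Q′\*)⁻¹ ≺ B₁(Lʲη)⁻⁴e^{−δd}
((3.48)), Q′, Q′\* block-local with norm κ_Q, the scale transfers of Lʲη, (Lʲη)², (Lʲη)⁻⁴ at exponent α (constant
Λ ≧ 1), (2.61) at β, (2.54), output rate ρ ≧ 0 with ρ + (2α + β)δ₀ ≦ δ — whence P = `B9Eq360Vprime.pOp G Qs Cinv Q`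
≺ κ₃₄₉e^{−ρd} ((3.49)₀, `ineq349_op`) — and, for the weighted step, (2.60) at exponent α′ and (2.61) at 1 − α′ for
the rate ρ together with 2·log L ≦ α′ρRM.  Conclusion: |f|₍₋₂₎ ≦ N implies |((I − P)f)(x)| ≦
(1 + κ₃₄₉·c₁(1−α′)·L²)(Lʲη)⁻²N for x ∈ Δ(y), y ∈ Λ_j — (1.98) R-half with **B′₀ = 1 + κ₃₄₉c₁(1−α′)L²**,
κ₃₄₉ = κ_Q²B₀²B₁Λ⁴c₁(β)² ("depending on d and L only" through the constants of Theorems 3.1/3.2 and Lemma 2.1).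
[cite: Balaban1985RegularSpaces, (1.98) p.92; Balaban1985BackgroundPropagators, Thm 3.1 (3.42) p.397, Thm 3.2 (3.48) p.398, (3.25) p.394, (3.49) p.399; Balaban1984PropagatorsII, Lemma 2.1 p.234] -/
theorem ineq198_R_of_thms3132 (blk : W → g.Site) (d : ℕ) (δ₀ δ α β ρ Λ κQ B₀ B₁ : ℝ)
    (hκQ : 0 ≤ κQ) (hB₀ : 0 ≤ B₀) (hB₁ : 0 ≤ B₁) (hΛ : 1 ≤ Λ) (hρ : 0 ≤ ρ) (hα : 0 ≤ α) (hβ : 0 ≤ β)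
    (hδ₀ : 0 ≤ δ₀) (hr : ρ + (2 * α + β) * δ₀ ≤ δ)
    (hdnn : ∀ a b : g.Site, 0 ≤ g.dist a b) (htri : Triangle254 (toB6 g R H)) (hL : 1 ≤ g.L) (hη : 0 < g.eta)
    (h261 : Ineq261 d (toB6 g R H) δ₀ β)
    (hT1 : ScaleTransfer g δ₀ α Λ (fun a => g.len a)) (hT2 : ScaleTransfer g δ₀ α Λ (fun a => g.len a ^ 2))
    (hT4 : ScaleTransfer g δ₀ α Λ (fun a => (g.len a ^ 4)⁻¹))
    {G D Ds Qs Q Cinv : Module.End ℝ (W → ℝ)}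
    (hQ : HasMajorant (g := toB6 g R H) blk Q (fun a b : g.Site => if a = b then κQ else 0))
    (hQs : HasMajorant (g := toB6 g R H) blk Qs (fun a b : g.Site => if a = b then κQ else 0))
    (hG : HasMajorant (g := toB6 g R H) blk G (fun a b => B₀ * g.len a ^ 2 * Real.exp (-(δ * g.dist a b))))
    (hDG : HasMajorant (g := toB6 g R H) blk (D * G) (fun a b => B₀ * g.len a * Real.exp (-(δ * g.dist a b))))
    (hGDs : HasMajorant (g := toB6 g R H) blk (G * Ds) (fun a b => B₀ * g.len a * Real.exp (-(δ * g.dist a b))))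
    (hCinv : HasMajorant (g := toB6 g R H) blk Cinv
      (fun a b => B₁ * (g.len a ^ 4)⁻¹ * Real.exp (-(δ * g.dist a b))))
    -- the weighted step: Lemma 2.1 at the output rate ρ, exponent α′, and the located size condition
    (α' : ℝ) (hsize : 2 * Real.log g.L ≤ α' * ρ * R * g.M)
    (h260ρ : Ineq260 (toB6 g R H) ρ α') (h261ρ : Ineq261 d (toB6 g R H) ρ (1 - α'))
    (N : ℝ) (hN : 0 ≤ N) (f : W → ℝ) (hf : ∀ x, |f x| ≤ (g.len (blk x)) ^ (-(2 : ℝ)) * N) (x : W) :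
    |(1 - B9Eq360Vprime.pOp G Qs Cinv Q) f x| ≤
      (1 + B9Ineq368PPrime.kappa349 κQ B₀ B₁ Λ (B6.c1 d δ₀ β) * B6.c1 d ρ (1 - α') * g.L ^ 2) *
        ((g.len (blk x)) ^ (-(2 : ℝ)) * N) := by
  have hL0 : 0 < g.L := lt_of_lt_of_le one_pos hL
  have hlen : ∀ y : g.Site, 0 < g.len y := fun y => by
    unfold B9.Geometry.len
    exact mul_pos (pow_pos hL0 _) hη
  -- (3.49)₀ in operator form
  have h349 := (B9Ineq368PPrime.ineq349_op (R := R) (H := H) blk d δ₀ δ α β ρ Λ κQ B₀ B₁ hκQ hB₀ hB₁ hΛ hρ hα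
    hβ hδ₀ hr hdnn htri hlen h261 hT1 hT2 hT4 hQ hQs hG hDG hGDs hCinv).1
  have hκ : 0 ≤ B9Ineq368PPrime.kappa349 κQ B₀ B₁ Λ (B6.c1 d δ₀ β) := by
    unfold B9Ineq368PPrime.kappa349
    have hc : 0 ≤ B6.c1 d δ₀ β := by
      classical
      obtain ⟨y⟩ : Nonempty g.Site := ⟨blk x⟩
      exact (Finset.sum_nonneg fun _ _ => Real.exp_nonneg _).trans (h261 y)
    have hΛ0 : 0 ≤ Λ := le_trans zero_le_one hΛ
    positivity
  exact ineq198_R (R := R) (H := H) blk d ρ α' _ N hκ hN hL hη hsize h260ρ h261ρ h349 f hf x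

end EndToEnd

/-! ## §4  Dictionary: B8's p. 86 norm `sup_j sup_{Ω_j}` (`B8ScaledSupNorm.msup`) vs the block form of [4] (3.41) -/

section Dictionary

variable {ι : Type*} {E : Type*} [SeminormedAddCommGroup E]

/-- **Block form ⇒ B8's norm** (B9 p. 397: «the norm |A|₍α₎ can be defined as the smallest number C such, that
|A(b)| ≦ C(Lʲη)^α for b ∈ Ω_j∖Ω_{j+1} … For α negative we can take Ω_j instead of Ω_j∖Ω_{j+1} above»; B8 p. 86
«|A|₍α₎ = sup_j sup_{Ω_j} (Lʲη)^{−α}|A|»).  Read the nested domain sequence through the top scale `sc i` of each index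
(`mem j i → j ≦ sc i`: an object of Ω_j lies in a block of scale ≧ j).  For α ≦ 0, L ≧ 1, η > 0, N ≧ 0: if
‖F i‖ ≦ (L^{sc i}η)^α·N for every i, then `msup L k η α mem F ≦ N`, i.e. |F|₍α₎ ≦ N.
[cite: Balaban1985RegularSpaces, p.86 (definition after (1.55)); Balaban1985BackgroundPropagators, (3.41) p.397] -/
theorem msup_le_of_blockwise {L k : ℕ} (hL : 1 ≤ L) {η : ℝ} (hη : 0 < η) {α : ℝ} (hα : α ≤ 0)
    {mem : ℕ → ι → Prop} (sc : ι → ℕ) (hmem : ∀ j i, mem j i → j ≤ sc i) {F : ι → E} {N : ℝ} (hN : 0 ≤ N)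
    (h : ∀ i, ‖F i‖ ≤ (((L : ℝ) ^ sc i * η) ^ α) * N) : B8ScaledSupNorm.msup L k η α mem F ≤ N := by
  refine B8ScaledSupNorm.msup_le_of_pointwise hL hη hN fun j _ i hi => ?_
  have hj : j ≤ sc i := hmem j i hi
  have hL1 : (1 : ℝ) ≤ (L : ℝ) := by exact_mod_cast hL
  have hpos : 0 < (L : ℝ) ^ j * η := B8ScaledSupNorm.scale_pos hL hη j
  have hle : (L : ℝ) ^ j * η ≤ (L : ℝ) ^ sc i * η :=
    mul_le_mul_of_nonneg_right (pow_le_pow_right₀ hL1 hj) hη.le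
  -- for α ≤ 0 the weight (·)^α is antitone: (L^{sc i}η)^α ≤ (L^jη)^α
  have hanti : ((L : ℝ) ^ sc i * η) ^ α ≤ ((L : ℝ) ^ j * η) ^ α := Real.rpow_le_rpow_of_nonpos hpos hle hα
  calc ‖F i‖ ≤ (((L : ℝ) ^ sc i * η) ^ α) * N := h i
    _ ≤ (((L : ℝ) ^ j * η) ^ α) * N := mul_le_mul_of_nonneg_right hanti hN
    _ = N * ((L : ℝ) ^ j * η) ^ α := mul_comm _ _

/-- **B8's norm ⇒ block form** (any real α): if every index lies in its top domain (`mem (sc i) i`, `sc i ≦ k`) and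
the weighted family is bounded, then `msup L k η α mem F ≦ N` gives ‖F i‖ ≦ (L^{sc i}η)^α·N for every i — the
hypothesis shape `|λ(x)| ≦ (L^{j(x)}η)^γ·N` of §§1–3. [cite: Balaban1985RegularSpaces, p.86 (definition after (1.55)); Balaban1985BackgroundPropagators, (3.41) p.397] -/
theorem blockwise_of_msup_le {L k : ℕ} (hL : 1 ≤ L) {η : ℝ} (hη : 0 < η) {α : ℝ}
    {mem : ℕ → ι → Prop} (sc : ι → ℕ) (hsc : ∀ i, sc i ≤ k) (htop : ∀ i, mem (sc i) i) {F : ι → E}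
    (hB : B8ScaledSupNorm.Bdd L k η α mem F) {N : ℝ} (h : B8ScaledSupNorm.msup L k η α mem F ≤ N) (i : ι) :
    ‖F i‖ ≤ (((L : ℝ) ^ sc i * η) ^ α) * N := by
  rw [mul_comm]
  exact B8ScaledSupNorm.norm_le_of_msup_le hL hη hB h (hsc i) (htop i)

end Dictionary

end Literature.MathematicalPhysics.QuantumFieldTheory.Balaban1983to89.B8Ineq198R

end
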